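import Literature.AlgebraicGeometry.Modules.PullbackReflectsIsoOfFlatSurjective
import Literature.AlgebraicGeometry.Modules.PullbackStalk
import Literature.Algebra.Homology.DerivedPlusConcentration
import HarnessLib

/-!
# Cohomological amplitude descends along a flat surjective morphism: if `D⁺(f^*) X` is concentrated in
# degree `i₀` then `X ≅ 𝓑[-i₀]` (fpqc descent of vanishing of cohomology sheaves; Stacks 06XU, 02KH; GW 14.50)

Layer `Literature/AlgebraicGeometry/Modules`. For a flat surjective morphism of schemes `f : X ⟶ Y` the exact functor
`f^* : Mod(𝒪_Y) ⥤ Mod(𝒪_X)` reflects isomorphisms (`Modules/PullbackReflectsIsoOfFlatSurjective`), hence is conservative; by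
`Algebra/Homology/DerivedPlusConcentration` cohomological amplitude descends along `D⁺(f^*)`:

* `reflectsIsomorphisms_pullback_of_flat_surjective` — `f^*` reflects isomorphisms (as a theorem; `haveI` at use);
* **`isLE_of_isLE_pullback_obj`**, **`isGE_of_isGE_pullback_obj`** — `D⁺(f^*) X ≤ n ⇒ X ≤ n`, `D⁺(f^*) X ≥ n ⇒ X ≥ n` for
  `X ∈ D⁺(Mod 𝒪_Y)`;
* **`exists_iso_singleFunctor_obj_of_pullback`** — if `D⁺(f^*) X` is `≥ i₀` and `≤ i₀` (e.g. isomorphic to a single sheaf in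
  degree `i₀`) then `X ≅ (singleFunctor i₀) 𝓑` for some `𝒪_Y`-module `𝓑` — the form in which «the descended transform on
  Markman's secant quotient is a shifted sheaf as soon as its pull-back to `A × Â` is» is consumed;
* `isGE_and_isLE_of_iso_singleFunctor_obj` — an object isomorphic to `(singleFunctor i₀) M` is `≥ i₀` and `≤ i₀`.

Everything PROVED; 0 named facts; no instances. Typed for the cell `pub-hodge-ring2` ((m-b-2)∕(m-b-3) of the kernel road); a
research route conditional on HC_CM, not a corollary — nothing in this file refers to it.

## References

* The Stacks Project, Tags 06XU (canonical t-structure), 02KH, 05B2 (fpqc descent of properties of modules). [StacksProject]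
* U. Görtz, T. Wedhorn, *Algebraic Geometry I*, 2nd ed. (2020), Prop. 14.50 (faithfully flat descent detects isomorphisms). [GortzWedhorn2020]
* A. Beilinson, J. Bernstein, P. Deligne, *Faisceaux pervers* (1982), §1.3. [BBD1982]
-/

noncomputable section

-- `TopCat.Presheaf`/`Scheme.Modules` are not reducible (as in Mathlib's `AlgebraicGeometry/Modules/Sheaf.lean`).
set_option backward.isDefEq.respectTransparency false

open CategoryTheory CategoryTheory.Limits AlgebraicGeometry
open Literature.Algebra.Homology

universe x₁ x₂ y₁

namespace Literature.AlgebraicGeometry.Modules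

variable {X Y : Scheme.{y₁}} (f : X ⟶ Y)

/-- **`f^*` reflects isomorphisms for `f` flat and surjective** (`isIso_of_isIso_pullback_map`, packaged).
[cite: GortzWedhorn2020, Prop 14.50] -/
theorem reflectsIsomorphisms_pullback_of_flat_surjective [Flat f] [Surjective f] :
    (Scheme.Modules.pullback f).ReflectsIsomorphisms :=
  ⟨fun φ _ => isIso_of_isIso_pullback_map f φ⟩

variable [HasDerivedCategory.{x₁} X.Modules] [HasDerivedCategory.{x₂} Y.Modules]

/-- **`D⁺(f^*) E ≤ n ⇒ E ≤ n`** for `f` flat surjective. [cite: StacksProject, Tag 06XU] [cite: GortzWedhorn2020, Prop 14.50] -/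
theorem isLE_of_isLE_pullback_obj [Flat f] [Surjective f] (E : DerivedCategory.Plus Y.Modules) (n : ℤ)
    [h : (haveI := preservesFiniteLimits_pullback_of_flat f
      (Scheme.Modules.pullback f).mapDerivedCategoryPlus).obj E |>.IsLE n] : E.IsLE n := by
  haveI := preservesFiniteLimits_pullback_of_flat f
  haveI := reflectsIsomorphisms_pullback_of_flat_surjective f
  exact isLE_of_isLE_mapDerivedCategoryPlus_obj (Scheme.Modules.pullback f) E n

/-- **`D⁺(f^*) E ≥ n ⇒ E ≥ n`** for `f` flat surjective. [cite: StacksProject, Tag 06XU] [cite: GortzWedhorn2020, Prop 14.50] -/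
theorem isGE_of_isGE_pullback_obj [Flat f] [Surjective f] (E : DerivedCategory.Plus Y.Modules) (n : ℤ)
    [h : (haveI := preservesFiniteLimits_pullback_of_flat f
      (Scheme.Modules.pullback f).mapDerivedCategoryPlus).obj E |>.IsGE n] : E.IsGE n := by
  haveI := preservesFiniteLimits_pullback_of_flat f
  haveI := reflectsIsomorphisms_pullback_of_flat_surjective f
  exact isGE_of_isGE_mapDerivedCategoryPlus_obj (Scheme.Modules.pullback f) E n

omit [HasDerivedCategory X.Modules] in
/-- An object of `D⁺` isomorphic to a single object in degree `i₀` is `≥ i₀` and `≤ i₀`. [cite: BBD1982, §1.3] -/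
theorem isGE_and_isLE_of_iso_singleFunctor_obj {E : DerivedCategory.Plus Y.Modules} {i₀ : ℤ} {M : Y.Modules}
    (e : E ≅ (DerivedCategory.Plus.singleFunctor Y.Modules i₀).obj M) : E.IsGE i₀ ∧ E.IsLE i₀ :=
  ⟨DerivedCategory.Plus.TStructure.t.isGE_of_iso e.symm i₀, DerivedCategory.Plus.TStructure.t.isLE_of_iso e.symm i₀⟩

/-- **If `D⁺(f^*) E` is concentrated in degree `i₀` then `E ≅ 𝓑[-i₀]` for some `𝒪_Y`-module `𝓑`** (`f` flat surjective).
[cite: StacksProject, Tag 06XU] [cite: GortzWedhorn2020, Prop 14.50] [cite: BBD1982, §1.3] -/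
theorem exists_iso_singleFunctor_obj_of_pullback [Flat f] [Surjective f] (E : DerivedCategory.Plus Y.Modules) (i₀ : ℤ)
    (hGE : (haveI := preservesFiniteLimits_pullback_of_flat f
      (Scheme.Modules.pullback f).mapDerivedCategoryPlus).obj E |>.IsGE i₀)
    (hLE : (haveI := preservesFiniteLimits_pullback_of_flat f
      (Scheme.Modules.pullback f).mapDerivedCategoryPlus).obj E |>.IsLE i₀) :
    ∃ 𝓑 : Y.Modules, Nonempty (E ≅ (DerivedCategory.Plus.singleFunctor Y.Modules i₀).obj 𝓑) := by
  haveI := hGE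
  haveI := hLE
  haveI := isLE_of_isLE_pullback_obj f E i₀
  haveI := isGE_of_isGE_pullback_obj f E i₀
  exact Plus.exists_iso_singleFunctor_obj_of_isGE_of_isLE E i₀

/-- The same with the concentration of `D⁺(f^*) E` given by an isomorphism with a single object upstairs.
[cite: StacksProject, Tag 06XU] [cite: GortzWedhorn2020, Prop 14.50] -/
theorem exists_iso_singleFunctor_obj_of_pullback_iso_single [Flat f] [Surjective f] (E : DerivedCategory.Plus Y.Modules)
    {i₀ : ℤ} {M' : X.Modules}
    (e : (haveI := preservesFiniteLimits_pullback_of_flat f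
      (Scheme.Modules.pullback f).mapDerivedCategoryPlus).obj E ≅ (DerivedCategory.Plus.singleFunctor X.Modules i₀).obj M') :
    ∃ 𝓑 : Y.Modules, Nonempty (E ≅ (DerivedCategory.Plus.singleFunctor Y.Modules i₀).obj 𝓑) :=
  exists_iso_singleFunctor_obj_of_pullback f E i₀
    (DerivedCategory.Plus.TStructure.t.isGE_of_iso e.symm i₀) (DerivedCategory.Plus.TStructure.t.isLE_of_iso e.symm i₀)

end Literature.AlgebraicGeometry.Modules

end
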